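import Summits.AnomalousDissipation.AnomalousDissipation.Theorems.SawtoothPulseCascadeK1LocalisedCascadeKHCreationNumericCosQuarter

/-!
# K2 lane (route-2 `SawtoothPulseCascade`, crux dir `K1LocalisedCascade`): the twelve-term creation bound as a NUMBER — `cos` entry, kink line `−¼`

Helper file of the K2 lane (ACL item stmt-AnomalousDissipation-19491; S2-cert forced part / P1″). For `a ≥ 1` and a block rate in the window
`0.55a ≤ ω ≤ πa/2 − 399/401` (`…KHStableDetuning`/`…KHStableRotation`), the twelve-term bound of `…KHSourceResponse` for the `cos` propagator entry and
the source at `y₀ = −¼` is at most **`0.163 / a ^ 2`** (`twelveTerm_cos_negQuarter_le`): term by term `height ≤ ε/((1−q)2κ)` with the decay factors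
`ε ∈ {1, 0.2237, 1/20, 0.0112, 1/400}` (`…KHCreationAtoms`), detuning `≤ 1.48` (kink phases) or `≤ 40/11` (frequency 0), coefficient `≤ 0.0654/a²`;
`Σ εD = 4.972`. With `…KHComponentAssembly` and `…KHBlockEntries`: single-mode creation amplitude `O(1/a)` explicitly (crux `K2StableCreation.lean`).
No definitions; no statement about the crux. [folklore] [problem: turb]
-/

-- `Summit.<Summit>.<Problem>`: single-conjunct summit, the duplicate namespace segment is deliberate.
set_option linter.dupNamespace false

noncomputable section

namespace Summit.AnomalousDissipation.AnomalousDissipation.Theorems.SawtoothPulseCascade.K2PhaseBudget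

open Set Literature.Analysis.FluidPDE.SawtoothCascade

/-- **`twelveTerm_cos_negQuarter_le`:** the twelve-term `cos` bound at `y₀ = −¼` is at most `0.163 / a ^ 2` for `a ≥ 1`, `ω` in the window. [folklore] -/
theorem twelveTerm_cos_negQuarter_le {a : ℝ} (ha : 1 ≤ a) (β : ℝ) {ω : ℝ} (hlo : 0.55 * a ≤ ω) (hhi : ω ≤ Real.pi * a / 2 - 399 / 401) :
    ((‖((1 : ℂ) * (-1 / ((1 - starRingEnd ℂ (Complex.exp (2 * Real.pi * β * Complex.I)) * (Real.exp (-(2 * Real.pi * a)) : ℂ)) * (2 * (2 * Real.pi * a)))) * Complex.exp (-((2 * Real.pi * a : ℝ) : ℂ) * (-(1 / 4 : ℝ))))‖ * Real.exp ((2 * Real.pi * a) * (-(1 / 4 : ℝ))) * (2 + Real.pi) / |(2 * Real.pi * a)| * (1 / |(Real.pi * a) + (2 * Real.pi * a) * (-(1 / 4 : ℝ)) - ω| + 1 / |(Real.pi * a) + (2 * Real.pi * a) * (-(1 / 4 : ℝ)) + ω|) * (1 / 2) +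
        ‖((1 : ℂ) * (-1 / ((1 - starRingEnd ℂ (Complex.exp (2 * Real.pi * β * Complex.I)) * (Real.exp (-(2 * Real.pi * a)) : ℂ)) * (2 * (2 * Real.pi * a)))) * Complex.exp (-((2 * Real.pi * a : ℝ) : ℂ) * (-(1 / 4 : ℝ))))‖ * Real.exp ((2 * Real.pi * a) * (-(1 / 2 : ℝ))) * (2 + Real.pi) / |(2 * Real.pi * a)| * (1 / |(Real.pi * a) + (2 * Real.pi * a) * (-(1 / 2 : ℝ)) - ω| + 1 / |(Real.pi * a) + (2 * Real.pi * a) * (-(1 / 2 : ℝ)) + ω|) * (1 / 2)) +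
      (‖((1 : ℂ) * (-(Complex.exp (2 * Real.pi * β * Complex.I) * (Real.exp (-(2 * Real.pi * a)) : ℂ)) / ((1 - Complex.exp (2 * Real.pi * β * Complex.I) * (Real.exp (-(2 * Real.pi * a)) : ℂ)) * (2 * (2 * Real.pi * a)))) * Complex.exp (((2 * Real.pi * a : ℝ) : ℂ) * (-(1 / 4 : ℝ))))‖ * Real.exp ((-(2 * Real.pi * a)) * (-(1 / 4 : ℝ))) * (2 + Real.pi) / |(-(2 * Real.pi * a))| * (1 / |(Real.pi * a) + (2 * Real.pi * a) * (-(1 / 4 : ℝ)) - ω| + 1 / |(Real.pi * a) + (2 * Real.pi * a) * (-(1 / 4 : ℝ)) + ω|) * (1 / 2) +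
        ‖((1 : ℂ) * (-(Complex.exp (2 * Real.pi * β * Complex.I) * (Real.exp (-(2 * Real.pi * a)) : ℂ)) / ((1 - Complex.exp (2 * Real.pi * β * Complex.I) * (Real.exp (-(2 * Real.pi * a)) : ℂ)) * (2 * (2 * Real.pi * a)))) * Complex.exp (((2 * Real.pi * a : ℝ) : ℂ) * (-(1 / 4 : ℝ))))‖ * Real.exp ((-(2 * Real.pi * a)) * (-(1 / 2 : ℝ))) * (2 + Real.pi) / |(-(2 * Real.pi * a))| * (1 / |(Real.pi * a) + (2 * Real.pi * a) * (-(1 / 2 : ℝ)) - ω| + 1 / |(Real.pi * a) + (2 * Real.pi * a) * (-(1 / 2 : ℝ)) + ω|) * (1 / 2))) +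
      ((‖((starRingEnd ℂ (Complex.exp (2 * Real.pi * β * Complex.I))) * (-1 / ((1 - starRingEnd ℂ (Complex.exp (2 * Real.pi * β * Complex.I)) * (Real.exp (-(2 * Real.pi * a)) : ℂ)) * (2 * (2 * Real.pi * a)))) * Complex.exp (-((2 * Real.pi * a : ℝ) : ℂ) * (3 / 4 : ℝ)))‖ * Real.exp ((2 * Real.pi * a) * (1 / 4 : ℝ)) * (2 + Real.pi) / |(2 * Real.pi * a)| * (1 / |(0 : ℝ) + (-(2 * Real.pi * a)) * (1 / 4 : ℝ) - ω| + 1 / |(0 : ℝ) + (-(2 * Real.pi * a)) * (1 / 4 : ℝ) + ω|) * (1 / 2) +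
        ‖((starRingEnd ℂ (Complex.exp (2 * Real.pi * β * Complex.I))) * (-1 / ((1 - starRingEnd ℂ (Complex.exp (2 * Real.pi * β * Complex.I)) * (Real.exp (-(2 * Real.pi * a)) : ℂ)) * (2 * (2 * Real.pi * a)))) * Complex.exp (-((2 * Real.pi * a : ℝ) : ℂ) * (3 / 4 : ℝ)))‖ * Real.exp ((2 * Real.pi * a) * (-(1 / 4 : ℝ))) * (2 + Real.pi) / |(2 * Real.pi * a)| * (1 / |(0 : ℝ) + (-(2 * Real.pi * a)) * (-(1 / 4 : ℝ)) - ω| + 1 / |(0 : ℝ) + (-(2 * Real.pi * a)) * (-(1 / 4 : ℝ)) + ω|) * (1 / 2)) +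
      (‖((starRingEnd ℂ (Complex.exp (2 * Real.pi * β * Complex.I))) * (-(Complex.exp (2 * Real.pi * β * Complex.I) * (Real.exp (-(2 * Real.pi * a)) : ℂ)) / ((1 - Complex.exp (2 * Real.pi * β * Complex.I) * (Real.exp (-(2 * Real.pi * a)) : ℂ)) * (2 * (2 * Real.pi * a)))) * Complex.exp (((2 * Real.pi * a : ℝ) : ℂ) * (3 / 4 : ℝ)))‖ * Real.exp ((-(2 * Real.pi * a)) * (1 / 4 : ℝ)) * (2 + Real.pi) / |(-(2 * Real.pi * a))| * (1 / |(0 : ℝ) + (-(2 * Real.pi * a)) * (1 / 4 : ℝ) - ω| + 1 / |(0 : ℝ) + (-(2 * Real.pi * a)) * (1 / 4 : ℝ) + ω|) * (1 / 2) +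
        ‖((starRingEnd ℂ (Complex.exp (2 * Real.pi * β * Complex.I))) * (-(Complex.exp (2 * Real.pi * β * Complex.I) * (Real.exp (-(2 * Real.pi * a)) : ℂ)) / ((1 - Complex.exp (2 * Real.pi * β * Complex.I) * (Real.exp (-(2 * Real.pi * a)) : ℂ)) * (2 * (2 * Real.pi * a)))) * Complex.exp (((2 * Real.pi * a : ℝ) : ℂ) * (3 / 4 : ℝ)))‖ * Real.exp ((-(2 * Real.pi * a)) * (-(1 / 4 : ℝ))) * (2 + Real.pi) / |(-(2 * Real.pi * a))| * (1 / |(0 : ℝ) + (-(2 * Real.pi * a)) * (-(1 / 4 : ℝ)) - ω| + 1 / |(0 : ℝ) + (-(2 * Real.pi * a)) * (-(1 / 4 : ℝ)) + ω|) * (1 / 2))) +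
      ((‖((starRingEnd ℂ (Complex.exp (2 * Real.pi * β * Complex.I))) * (-1 / ((1 - starRingEnd ℂ (Complex.exp (2 * Real.pi * β * Complex.I)) * (Real.exp (-(2 * Real.pi * a)) : ℂ)) * (2 * (2 * Real.pi * a)))) * Complex.exp (-((2 * Real.pi * a : ℝ) : ℂ) * (3 / 4 : ℝ)))‖ * Real.exp ((2 * Real.pi * a) * (1 / 2 : ℝ)) * (2 + Real.pi) / |(2 * Real.pi * a)| * (1 / |(-(Real.pi * a)) + (2 * Real.pi * a) * (1 / 2 : ℝ) - ω| + 1 / |(-(Real.pi * a)) + (2 * Real.pi * a) * (1 / 2 : ℝ) + ω|) * (1 / 2) +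
        ‖((starRingEnd ℂ (Complex.exp (2 * Real.pi * β * Complex.I))) * (-1 / ((1 - starRingEnd ℂ (Complex.exp (2 * Real.pi * β * Complex.I)) * (Real.exp (-(2 * Real.pi * a)) : ℂ)) * (2 * (2 * Real.pi * a)))) * Complex.exp (-((2 * Real.pi * a : ℝ) : ℂ) * (3 / 4 : ℝ)))‖ * Real.exp ((2 * Real.pi * a) * (1 / 4 : ℝ)) * (2 + Real.pi) / |(2 * Real.pi * a)| * (1 / |(-(Real.pi * a)) + (2 * Real.pi * a) * (1 / 4 : ℝ) - ω| + 1 / |(-(Real.pi * a)) + (2 * Real.pi * a) * (1 / 4 : ℝ) + ω|) * (1 / 2)) +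
      (‖((starRingEnd ℂ (Complex.exp (2 * Real.pi * β * Complex.I))) * (-(Complex.exp (2 * Real.pi * β * Complex.I) * (Real.exp (-(2 * Real.pi * a)) : ℂ)) / ((1 - Complex.exp (2 * Real.pi * β * Complex.I) * (Real.exp (-(2 * Real.pi * a)) : ℂ)) * (2 * (2 * Real.pi * a)))) * Complex.exp (((2 * Real.pi * a : ℝ) : ℂ) * (3 / 4 : ℝ)))‖ * Real.exp ((-(2 * Real.pi * a)) * (1 / 2 : ℝ)) * (2 + Real.pi) / |(-(2 * Real.pi * a))| * (1 / |(-(Real.pi * a)) + (2 * Real.pi * a) * (1 / 2 : ℝ) - ω| + 1 / |(-(Real.pi * a)) + (2 * Real.pi * a) * (1 / 2 : ℝ) + ω|) * (1 / 2) +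
        ‖((starRingEnd ℂ (Complex.exp (2 * Real.pi * β * Complex.I))) * (-(Complex.exp (2 * Real.pi * β * Complex.I) * (Real.exp (-(2 * Real.pi * a)) : ℂ)) / ((1 - Complex.exp (2 * Real.pi * β * Complex.I) * (Real.exp (-(2 * Real.pi * a)) : ℂ)) * (2 * (2 * Real.pi * a)))) * Complex.exp (((2 * Real.pi * a : ℝ) : ℂ) * (3 / 4 : ℝ)))‖ * Real.exp ((-(2 * Real.pi * a)) * (1 / 4 : ℝ)) * (2 + Real.pi) / |(-(2 * Real.pi * a))| * (1 / |(-(Real.pi * a)) + (2 * Real.pi * a) * (1 / 4 : ℝ) - ω| + 1 / |(-(Real.pi * a)) + (2 * Real.pi * a) * (1 / 4 : ℝ) + ω|) * (1 / 2))) ≤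
      0.163 / a ^ 2 := by
  have ha0 : 0 < a := by linarith
  have hκ : (0 : ℝ) < 2 * Real.pi * a := by positivity
  have hr0 : (0:ℝ) ≤ (1 / 2) := by norm_num
  have t0 : ‖((1 : ℂ) * (-1 / ((1 - starRingEnd ℂ (Complex.exp (2 * Real.pi * β * Complex.I)) * (Real.exp (-(2 * Real.pi * a)) : ℂ)) * (2 * (2 * Real.pi * a)))) * Complex.exp (-((2 * Real.pi * a : ℝ) : ℂ) * (-(1 / 4 : ℝ))))‖ * Real.exp ((2 * Real.pi * a) * (-(1 / 4 : ℝ))) * (2 + Real.pi) / |(2 * Real.pi * a)| * (1 / |(Real.pi * a) + (2 * Real.pi * a) * (-(1 / 4 : ℝ)) - ω| + 1 / |(Real.pi * a) + (2 * Real.pi * a) * (-(1 / 4 : ℝ)) + ω|) * (1 / 2) ≤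
      1 / ((1 - Real.exp (-(2 * Real.pi * a))) * (2 * (2 * Real.pi * a))) * (2 + Real.pi) / (2 * Real.pi * a) * 1.48 * (1 / 2) :=
    term_le_of (norm_nonneg _) (Real.exp_pos _).le (heightA_neg_le ha0 β norm_one (le_of_eq (by rw [show ((-(1 / 4 : ℝ)) - (-(1 / 4 : ℝ))) = (0:ℝ) by norm_num, mul_zero, Real.exp_zero]))) (abs_of_pos hκ) hκ (by positivity) (by rw [show (Real.pi * a) + (2 * Real.pi * a) * (-(1 / 4 : ℝ)) = Real.pi * a / 2 by ring]; exact detune_pos_le ha hlo hhi) hr0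
  have g0 := t0.trans (termBound_le ha (ε := 1) (D := 1.48) (r := (1 / 2)) (by norm_num) (by norm_num) hr0)
  have t1 : ‖((1 : ℂ) * (-1 / ((1 - starRingEnd ℂ (Complex.exp (2 * Real.pi * β * Complex.I)) * (Real.exp (-(2 * Real.pi * a)) : ℂ)) * (2 * (2 * Real.pi * a)))) * Complex.exp (-((2 * Real.pi * a : ℝ) : ℂ) * (-(1 / 4 : ℝ))))‖ * Real.exp ((2 * Real.pi * a) * (-(1 / 2 : ℝ))) * (2 + Real.pi) / |(2 * Real.pi * a)| * (1 / |(Real.pi * a) + (2 * Real.pi * a) * (-(1 / 2 : ℝ)) - ω| + 1 / |(Real.pi * a) + (2 * Real.pi * a) * (-(1 / 2 : ℝ)) + ω|) * (1 / 2) ≤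
      0.2237 / ((1 - Real.exp (-(2 * Real.pi * a))) * (2 * (2 * Real.pi * a))) * (2 + Real.pi) / (2 * Real.pi * a) * (40 / 11) * (1 / 2) :=
    term_le_of (norm_nonneg _) (Real.exp_pos _).le (heightA_neg_le ha0 β norm_one (by rw [show ((-(1 / 4 : ℝ)) - (-(1 / 2 : ℝ))) = (1/4:ℝ) by norm_num]; exact exp_neg_kappa_quarter_le ha)) (abs_of_pos hκ) hκ (by positivity) (by rw [show (Real.pi * a) + (2 * Real.pi * a) * (-(1 / 2 : ℝ)) = (0:ℝ) by ring]; exact detune_zero_le' ha hlo) hr0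
  have g1 := t1.trans (termBound_le ha (ε := 0.2237) (D := (40 / 11)) (r := (1 / 2)) (by norm_num) (by norm_num) hr0)
  have t2 : ‖((1 : ℂ) * (-(Complex.exp (2 * Real.pi * β * Complex.I) * (Real.exp (-(2 * Real.pi * a)) : ℂ)) / ((1 - Complex.exp (2 * Real.pi * β * Complex.I) * (Real.exp (-(2 * Real.pi * a)) : ℂ)) * (2 * (2 * Real.pi * a)))) * Complex.exp (((2 * Real.pi * a : ℝ) : ℂ) * (-(1 / 4 : ℝ))))‖ * Real.exp ((-(2 * Real.pi * a)) * (-(1 / 4 : ℝ))) * (2 + Real.pi) / |(-(2 * Real.pi * a))| * (1 / |(Real.pi * a) + (2 * Real.pi * a) * (-(1 / 4 : ℝ)) - ω| + 1 / |(Real.pi * a) + (2 * Real.pi * a) * (-(1 / 4 : ℝ)) + ω|) * (1 / 2) ≤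
      (1 / 400) / ((1 - Real.exp (-(2 * Real.pi * a))) * (2 * (2 * Real.pi * a))) * (2 + Real.pi) / (2 * Real.pi * a) * 1.48 * (1 / 2) :=
    term_le_of (norm_nonneg _) (Real.exp_pos _).le (heightB_neg_le ha0 β norm_one (by rw [show (1 - ((-(1 / 4 : ℝ)) - (-(1 / 4 : ℝ)))) = (1:ℝ) by norm_num, mul_one]; exact exp_neg_kappa_le ha)) (by rw [abs_neg, abs_of_pos hκ]) hκ (by positivity) (by rw [show (Real.pi * a) + (2 * Real.pi * a) * (-(1 / 4 : ℝ)) = Real.pi * a / 2 by ring]; exact detune_pos_le ha hlo hhi) hr0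
  have g2 := t2.trans (termBound_le ha (ε := (1 / 400)) (D := 1.48) (r := (1 / 2)) (by norm_num) (by norm_num) hr0)
  have t3 : ‖((1 : ℂ) * (-(Complex.exp (2 * Real.pi * β * Complex.I) * (Real.exp (-(2 * Real.pi * a)) : ℂ)) / ((1 - Complex.exp (2 * Real.pi * β * Complex.I) * (Real.exp (-(2 * Real.pi * a)) : ℂ)) * (2 * (2 * Real.pi * a)))) * Complex.exp (((2 * Real.pi * a : ℝ) : ℂ) * (-(1 / 4 : ℝ))))‖ * Real.exp ((-(2 * Real.pi * a)) * (-(1 / 2 : ℝ))) * (2 + Real.pi) / |(-(2 * Real.pi * a))| * (1 / |(Real.pi * a) + (2 * Real.pi * a) * (-(1 / 2 : ℝ)) - ω| + 1 / |(Real.pi * a) + (2 * Real.pi * a) * (-(1 / 2 : ℝ)) + ω|) * (1 / 2) ≤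
      0.0112 / ((1 - Real.exp (-(2 * Real.pi * a))) * (2 * (2 * Real.pi * a))) * (2 + Real.pi) / (2 * Real.pi * a) * (40 / 11) * (1 / 2) :=
    term_le_of (norm_nonneg _) (Real.exp_pos _).le (heightB_neg_le ha0 β norm_one (by rw [show (1 - ((-(1 / 4 : ℝ)) - (-(1 / 2 : ℝ)))) = (3/4:ℝ) by norm_num]; exact exp_neg_kappa_threeQuarter_le ha)) (by rw [abs_neg, abs_of_pos hκ]) hκ (by positivity) (by rw [show (Real.pi * a) + (2 * Real.pi * a) * (-(1 / 2 : ℝ)) = (0:ℝ) by ring]; exact detune_zero_le' ha hlo) hr0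
  have g3 := t3.trans (termBound_le ha (ε := 0.0112) (D := (40 / 11)) (r := (1 / 2)) (by norm_num) (by norm_num) hr0)
  have t4 : ‖((starRingEnd ℂ (Complex.exp (2 * Real.pi * β * Complex.I))) * (-1 / ((1 - starRingEnd ℂ (Complex.exp (2 * Real.pi * β * Complex.I)) * (Real.exp (-(2 * Real.pi * a)) : ℂ)) * (2 * (2 * Real.pi * a)))) * Complex.exp (-((2 * Real.pi * a : ℝ) : ℂ) * (3 / 4 : ℝ)))‖ * Real.exp ((2 * Real.pi * a) * (1 / 4 : ℝ)) * (2 + Real.pi) / |(2 * Real.pi * a)| * (1 / |(0 : ℝ) + (-(2 * Real.pi * a)) * (1 / 4 : ℝ) - ω| + 1 / |(0 : ℝ) + (-(2 * Real.pi * a)) * (1 / 4 : ℝ) + ω|) * (1 / 2) ≤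
      (1 / 20) / ((1 - Real.exp (-(2 * Real.pi * a))) * (2 * (2 * Real.pi * a))) * (2 + Real.pi) / (2 * Real.pi * a) * 1.48 * (1 / 2) :=
    term_le_of (norm_nonneg _) (Real.exp_pos _).le (heightA_le ha0 β (norm_pref_conj β) (by rw [show ((3 / 4 : ℝ) - (1 / 4 : ℝ)) = (1/2:ℝ) by norm_num]; exact exp_neg_kappa_half_le ha)) (abs_of_pos hκ) hκ (by positivity) (by rw [show (0 : ℝ) + (-(2 * Real.pi * a)) * (1 / 4 : ℝ) = -(Real.pi * a / 2) by ring]; exact detune_neg_le ha hlo hhi) hr0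
  have g4 := t4.trans (termBound_le ha (ε := (1 / 20)) (D := 1.48) (r := (1 / 2)) (by norm_num) (by norm_num) hr0)
  have t5 : ‖((starRingEnd ℂ (Complex.exp (2 * Real.pi * β * Complex.I))) * (-1 / ((1 - starRingEnd ℂ (Complex.exp (2 * Real.pi * β * Complex.I)) * (Real.exp (-(2 * Real.pi * a)) : ℂ)) * (2 * (2 * Real.pi * a)))) * Complex.exp (-((2 * Real.pi * a : ℝ) : ℂ) * (3 / 4 : ℝ)))‖ * Real.exp ((2 * Real.pi * a) * (-(1 / 4 : ℝ))) * (2 + Real.pi) / |(2 * Real.pi * a)| * (1 / |(0 : ℝ) + (-(2 * Real.pi * a)) * (-(1 / 4 : ℝ)) - ω| + 1 / |(0 : ℝ) + (-(2 * Real.pi * a)) * (-(1 / 4 : ℝ)) + ω|) * (1 / 2) ≤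
      (1 / 400) / ((1 - Real.exp (-(2 * Real.pi * a))) * (2 * (2 * Real.pi * a))) * (2 + Real.pi) / (2 * Real.pi * a) * 1.48 * (1 / 2) :=
    term_le_of (norm_nonneg _) (Real.exp_pos _).le (heightA_le ha0 β (norm_pref_conj β) (by rw [show ((3 / 4 : ℝ) - (-(1 / 4 : ℝ))) = (1:ℝ) by norm_num, mul_one]; exact exp_neg_kappa_le ha)) (abs_of_pos hκ) hκ (by positivity) (by rw [show (0 : ℝ) + (-(2 * Real.pi * a)) * (-(1 / 4 : ℝ)) = Real.pi * a / 2 by ring]; exact detune_pos_le ha hlo hhi) hr0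
  have g5 := t5.trans (termBound_le ha (ε := (1 / 400)) (D := 1.48) (r := (1 / 2)) (by norm_num) (by norm_num) hr0)
  have t6 : ‖((starRingEnd ℂ (Complex.exp (2 * Real.pi * β * Complex.I))) * (-(Complex.exp (2 * Real.pi * β * Complex.I) * (Real.exp (-(2 * Real.pi * a)) : ℂ)) / ((1 - Complex.exp (2 * Real.pi * β * Complex.I) * (Real.exp (-(2 * Real.pi * a)) : ℂ)) * (2 * (2 * Real.pi * a)))) * Complex.exp (((2 * Real.pi * a : ℝ) : ℂ) * (3 / 4 : ℝ)))‖ * Real.exp ((-(2 * Real.pi * a)) * (1 / 4 : ℝ)) * (2 + Real.pi) / |(-(2 * Real.pi * a))| * (1 / |(0 : ℝ) + (-(2 * Real.pi * a)) * (1 / 4 : ℝ) - ω| + 1 / |(0 : ℝ) + (-(2 * Real.pi * a)) * (1 / 4 : ℝ) + ω|) * (1 / 2) ≤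
      (1 / 20) / ((1 - Real.exp (-(2 * Real.pi * a))) * (2 * (2 * Real.pi * a))) * (2 + Real.pi) / (2 * Real.pi * a) * 1.48 * (1 / 2) :=
    term_le_of (norm_nonneg _) (Real.exp_pos _).le (heightB_le ha0 β (norm_pref_conj β) (by rw [show (1 - ((3 / 4 : ℝ) - (1 / 4 : ℝ))) = (1/2:ℝ) by norm_num]; exact exp_neg_kappa_half_le ha)) (by rw [abs_neg, abs_of_pos hκ]) hκ (by positivity) (by rw [show (0 : ℝ) + (-(2 * Real.pi * a)) * (1 / 4 : ℝ) = -(Real.pi * a / 2) by ring]; exact detune_neg_le ha hlo hhi) hr0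
  have g6 := t6.trans (termBound_le ha (ε := (1 / 20)) (D := 1.48) (r := (1 / 2)) (by norm_num) (by norm_num) hr0)
  have t7 : ‖((starRingEnd ℂ (Complex.exp (2 * Real.pi * β * Complex.I))) * (-(Complex.exp (2 * Real.pi * β * Complex.I) * (Real.exp (-(2 * Real.pi * a)) : ℂ)) / ((1 - Complex.exp (2 * Real.pi * β * Complex.I) * (Real.exp (-(2 * Real.pi * a)) : ℂ)) * (2 * (2 * Real.pi * a)))) * Complex.exp (((2 * Real.pi * a : ℝ) : ℂ) * (3 / 4 : ℝ)))‖ * Real.exp ((-(2 * Real.pi * a)) * (-(1 / 4 : ℝ))) * (2 + Real.pi) / |(-(2 * Real.pi * a))| * (1 / |(0 : ℝ) + (-(2 * Real.pi * a)) * (-(1 / 4 : ℝ)) - ω| + 1 / |(0 : ℝ) + (-(2 * Real.pi * a)) * (-(1 / 4 : ℝ)) + ω|) * (1 / 2) ≤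
      1 / ((1 - Real.exp (-(2 * Real.pi * a))) * (2 * (2 * Real.pi * a))) * (2 + Real.pi) / (2 * Real.pi * a) * 1.48 * (1 / 2) :=
    term_le_of (norm_nonneg _) (Real.exp_pos _).le (heightB_le ha0 β (norm_pref_conj β) (le_of_eq (by rw [show (1 - ((3 / 4 : ℝ) - (-(1 / 4 : ℝ)))) = (0:ℝ) by norm_num, mul_zero, Real.exp_zero]))) (by rw [abs_neg, abs_of_pos hκ]) hκ (by positivity) (by rw [show (0 : ℝ) + (-(2 * Real.pi * a)) * (-(1 / 4 : ℝ)) = Real.pi * a / 2 by ring]; exact detune_pos_le ha hlo hhi) hr0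
  have g7 := t7.trans (termBound_le ha (ε := 1) (D := 1.48) (r := (1 / 2)) (by norm_num) (by norm_num) hr0)
  have t8 : ‖((starRingEnd ℂ (Complex.exp (2 * Real.pi * β * Complex.I))) * (-1 / ((1 - starRingEnd ℂ (Complex.exp (2 * Real.pi * β * Complex.I)) * (Real.exp (-(2 * Real.pi * a)) : ℂ)) * (2 * (2 * Real.pi * a)))) * Complex.exp (-((2 * Real.pi * a : ℝ) : ℂ) * (3 / 4 : ℝ)))‖ * Real.exp ((2 * Real.pi * a) * (1 / 2 : ℝ)) * (2 + Real.pi) / |(2 * Real.pi * a)| * (1 / |(-(Real.pi * a)) + (2 * Real.pi * a) * (1 / 2 : ℝ) - ω| + 1 / |(-(Real.pi * a)) + (2 * Real.pi * a) * (1 / 2 : ℝ) + ω|) * (1 / 2) ≤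
      0.2237 / ((1 - Real.exp (-(2 * Real.pi * a))) * (2 * (2 * Real.pi * a))) * (2 + Real.pi) / (2 * Real.pi * a) * (40 / 11) * (1 / 2) :=
    term_le_of (norm_nonneg _) (Real.exp_pos _).le (heightA_le ha0 β (norm_pref_conj β) (by rw [show ((3 / 4 : ℝ) - (1 / 2 : ℝ)) = (1/4:ℝ) by norm_num]; exact exp_neg_kappa_quarter_le ha)) (abs_of_pos hκ) hκ (by positivity) (by rw [show (-(Real.pi * a)) + (2 * Real.pi * a) * (1 / 2 : ℝ) = (0:ℝ) by ring]; exact detune_zero_le' ha hlo) hr0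
  have g8 := t8.trans (termBound_le ha (ε := 0.2237) (D := (40 / 11)) (r := (1 / 2)) (by norm_num) (by norm_num) hr0)
  have t9 : ‖((starRingEnd ℂ (Complex.exp (2 * Real.pi * β * Complex.I))) * (-1 / ((1 - starRingEnd ℂ (Complex.exp (2 * Real.pi * β * Complex.I)) * (Real.exp (-(2 * Real.pi * a)) : ℂ)) * (2 * (2 * Real.pi * a)))) * Complex.exp (-((2 * Real.pi * a : ℝ) : ℂ) * (3 / 4 : ℝ)))‖ * Real.exp ((2 * Real.pi * a) * (1 / 4 : ℝ)) * (2 + Real.pi) / |(2 * Real.pi * a)| * (1 / |(-(Real.pi * a)) + (2 * Real.pi * a) * (1 / 4 : ℝ) - ω| + 1 / |(-(Real.pi * a)) + (2 * Real.pi * a) * (1 / 4 : ℝ) + ω|) * (1 / 2) ≤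
      (1 / 20) / ((1 - Real.exp (-(2 * Real.pi * a))) * (2 * (2 * Real.pi * a))) * (2 + Real.pi) / (2 * Real.pi * a) * 1.48 * (1 / 2) :=
    term_le_of (norm_nonneg _) (Real.exp_pos _).le (heightA_le ha0 β (norm_pref_conj β) (by rw [show ((3 / 4 : ℝ) - (1 / 4 : ℝ)) = (1/2:ℝ) by norm_num]; exact exp_neg_kappa_half_le ha)) (abs_of_pos hκ) hκ (by positivity) (by rw [show (-(Real.pi * a)) + (2 * Real.pi * a) * (1 / 4 : ℝ) = -(Real.pi * a / 2) by ring]; exact detune_neg_le ha hlo hhi) hr0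
  have g9 := t9.trans (termBound_le ha (ε := (1 / 20)) (D := 1.48) (r := (1 / 2)) (by norm_num) (by norm_num) hr0)
  have t10 : ‖((starRingEnd ℂ (Complex.exp (2 * Real.pi * β * Complex.I))) * (-(Complex.exp (2 * Real.pi * β * Complex.I) * (Real.exp (-(2 * Real.pi * a)) : ℂ)) / ((1 - Complex.exp (2 * Real.pi * β * Complex.I) * (Real.exp (-(2 * Real.pi * a)) : ℂ)) * (2 * (2 * Real.pi * a)))) * Complex.exp (((2 * Real.pi * a : ℝ) : ℂ) * (3 / 4 : ℝ)))‖ * Real.exp ((-(2 * Real.pi * a)) * (1 / 2 : ℝ)) * (2 + Real.pi) / |(-(2 * Real.pi * a))| * (1 / |(-(Real.pi * a)) + (2 * Real.pi * a) * (1 / 2 : ℝ) - ω| + 1 / |(-(Real.pi * a)) + (2 * Real.pi * a) * (1 / 2 : ℝ) + ω|) * (1 / 2) ≤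
      0.0112 / ((1 - Real.exp (-(2 * Real.pi * a))) * (2 * (2 * Real.pi * a))) * (2 + Real.pi) / (2 * Real.pi * a) * (40 / 11) * (1 / 2) :=
    term_le_of (norm_nonneg _) (Real.exp_pos _).le (heightB_le ha0 β (norm_pref_conj β) (by rw [show (1 - ((3 / 4 : ℝ) - (1 / 2 : ℝ))) = (3/4:ℝ) by norm_num]; exact exp_neg_kappa_threeQuarter_le ha)) (by rw [abs_neg, abs_of_pos hκ]) hκ (by positivity) (by rw [show (-(Real.pi * a)) + (2 * Real.pi * a) * (1 / 2 : ℝ) = (0:ℝ) by ring]; exact detune_zero_le' ha hlo) hr0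
  have g10 := t10.trans (termBound_le ha (ε := 0.0112) (D := (40 / 11)) (r := (1 / 2)) (by norm_num) (by norm_num) hr0)
  have t11 : ‖((starRingEnd ℂ (Complex.exp (2 * Real.pi * β * Complex.I))) * (-(Complex.exp (2 * Real.pi * β * Complex.I) * (Real.exp (-(2 * Real.pi * a)) : ℂ)) / ((1 - Complex.exp (2 * Real.pi * β * Complex.I) * (Real.exp (-(2 * Real.pi * a)) : ℂ)) * (2 * (2 * Real.pi * a)))) * Complex.exp (((2 * Real.pi * a : ℝ) : ℂ) * (3 / 4 : ℝ)))‖ * Real.exp ((-(2 * Real.pi * a)) * (1 / 4 : ℝ)) * (2 + Real.pi) / |(-(2 * Real.pi * a))| * (1 / |(-(Real.pi * a)) + (2 * Real.pi * a) * (1 / 4 : ℝ) - ω| + 1 / |(-(Real.pi * a)) + (2 * Real.pi * a) * (1 / 4 : ℝ) + ω|) * (1 / 2) ≤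
      (1 / 20) / ((1 - Real.exp (-(2 * Real.pi * a))) * (2 * (2 * Real.pi * a))) * (2 + Real.pi) / (2 * Real.pi * a) * 1.48 * (1 / 2) :=
    term_le_of (norm_nonneg _) (Real.exp_pos _).le (heightB_le ha0 β (norm_pref_conj β) (by rw [show (1 - ((3 / 4 : ℝ) - (1 / 4 : ℝ))) = (1/2:ℝ) by norm_num]; exact exp_neg_kappa_half_le ha)) (by rw [abs_neg, abs_of_pos hκ]) hκ (by positivity) (by rw [show (-(Real.pi * a)) + (2 * Real.pi * a) * (1 / 4 : ℝ) = -(Real.pi * a / 2) by ring]; exact detune_neg_le ha hlo hhi) hr0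
  have g11 := t11.trans (termBound_le ha (ε := (1 / 20)) (D := 1.48) (r := (1 / 2)) (by norm_num) (by norm_num) hr0)
  have hsum := add_le_add (add_le_add (add_le_add (add_le_add g0 g1) (add_le_add g2 g3)) (add_le_add (add_le_add g4 g5) (add_le_add g6 g7)))
    (add_le_add (add_le_add g8 g9) (add_le_add g10 g11))
  refine hsum.trans ?_
  have hfin : (0 : ℝ) < a ^ 2 := by positivity
  rw [← add_div, ← add_div, ← add_div, ← add_div, ← add_div, ← add_div, ← add_div, ← add_div, ← add_div, ← add_div, ← add_div]
  exact div_le_div_of_nonneg_right (by norm_num) hfin.le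

end Summit.AnomalousDissipation.AnomalousDissipation.Theorems.SawtoothPulseCascade.K2PhaseBudget

end
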